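import Literature.Geometry.Riemannian.SphereNormalField
import Literature.Geometry.Riemannian.ConeRadialIsometryInjective
import Literature.Geometry.Riemannian.MaximalGeodesicRescaling
import Literature.Geometry.Lorentzian.LeviCivitaProofs
import HarnessLib

/-!
# The collar cone map of the round sphere in a model open set, in coordinates

Topic `Geometry/Riemannian`. In the round picture of the interior surgery of Weinstein's disk
(Weinstein 1968, proof of the main theorem, step (3)) the boundary sphere `S = {‖v‖ = 1}` of the
model open set `U : Opens V` carries the Riemannian chart metric `g_U` (components `G_U`) and its
`g_U`-unit outward normal field `ν` (`SphereNormalField.lean`). The **cone map**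
`C(v) = exp_{ι v}((‖v‖ - 1) ν(ι v))` (`ι(v) = φ⁻¹(v/‖v‖)`, `ConeRadialIsometry.lean`) is a smooth
injective immersion of an annulus (`ConeRadialIsometryInjective.exists_injOn_coneMap`). This file
reads it in the coordinates of `U`, `Cf = (↑) ∘ C : V → V`, in the form consumed by
`UnwindingMap.exists_unwinding_extension`:

* `exists_roundConeMap` — **there is `ε ∈ (0, 1)` such that for the coordinate cone map `Cf`:
  `Cf` is `C^∞` on the annulus `{1-ε < ‖v‖ < 1+ε}`, `Cf u = u` on the unit sphere,
  `D Cf_u(u) = ν(u)` there (radial derivative = unit normal), and the Gauss identities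
  `G_U(Cf v)(D Cf_v v, D Cf_v v) = ‖v‖²`, `G_U(Cf v)(D Cf_v v, D Cf_v β) = 0` (`β ⊥ v`) hold on the
  annulus.**

## References

* A. Weinstein, Ann. of Math. (2) 87 (1968), 29–41, proof of the main theorem, step (3).
  [cite: Weinstein1968]
* J. M. Lee, *Introduction to Riemannian Manifolds*, 2nd ed. (2018), Thm. 6.38 (Gauss lemma for
  submanifolds). [cite: LeeRiemannianManifolds2018, Thm. 6.38]

Tags: [ConeMap] [Sphere] [Weinstein1968]
-/

noncomputable section

open Bundle Set Function Filter TopologicalSpace Metric Module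
open scoped Manifold ContDiff Topology RealInnerProductSpace

namespace Literature.Geometry.Riemannian

open Literature.Geometry.Lorentzian
open Literature.Geometry.Lorentzian.OpensChart
open Literature.Geometry.Lorentzian.PseudoRiemannianMetric

variable {V : Type*} [NormedAddCommGroup V] [InnerProductSpace ℝ V] [FiniteDimensional ℝ V]
  {U : Opens V}
  (gU : PseudoRiemannianMetric 𝓘(ℝ, V) ∞ V (TangentSpace 𝓘(ℝ, V) : U → Type _)) [gU.HasLeviCivita]
  (GU : V → V →L[ℝ] V →L[ℝ] ℝ)

omit [FiniteDimensional ℝ V] [gU.HasLeviCivita] in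
/-- The differential of the inclusion `U → V` is the identity. [folklore] -/
theorem mfderiv_subtype_val_apply (y : U) (w : V) :
    mfderiv 𝓘(ℝ, V) 𝓘(ℝ, V) (fun z : U ↦ (z : V)) y w = w := by
  have hfun : (fun z : U ↦ (z : V)) = extChartAt 𝓘(ℝ, V) y := by
    funext z; exact (OpensChart.extChartAt_apply y z).symm
  rw [hfun]
  exact OpensChart.mfderiv_extChartAt_apply y w

set_option maxHeartbeats 1600000 in
/-- **The coordinate cone map of the round sphere.** See the module docstring.
[cite: Weinstein1968, proof of the main theorem, step (3)] -/
theorem exists_roundConeMap {d : ℕ} (hdimE : finrank ℝ V = d + 1) (hG : ∀ y : U, gU.val y = GU y)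
    (hgU : gU.IsRiemannian) (u₀ : U) (hSU : ∀ w : V, ‖w‖ = 1 → w ∈ U) :
    ∃ ε : ℝ, 0 < ε ∧ ε < 1 ∧ ∀ Cf : V → V,
      (∀ v : V, Cf v = ((expMap gU.leviCivita ((extChartAt 𝓘(ℝ, V) u₀).symm (‖v‖⁻¹ • v))
        ((‖v‖ - 1) • ((Real.sqrt (GU (((extChartAt 𝓘(ℝ, V) u₀).symm (‖v‖⁻¹ • v) : U) : V) ((GU (((extChartAt 𝓘(ℝ, V) u₀).symm (‖v‖⁻¹ • v) : U) : V)).inverse (innerSL ℝ (((extChartAt 𝓘(ℝ, V) u₀).symm (‖v‖⁻¹ • v) : U) : V))) ((GU (((extChartAt 𝓘(ℝ, V) u₀).symm (‖v‖⁻¹ • v) : U) : V)).inverse (innerSL ℝ (((extChartAt 𝓘(ℝ, V) u₀).symm (‖v‖⁻¹ • v) : U) : V)))))⁻¹ • (GU (((extChartAt 𝓘(ℝ, V) u₀).symm (‖v‖⁻¹ • v) : U) : V)).inverse (innerSL ℝ (((extChartAt 𝓘(ℝ, V) u₀).symm (‖v‖⁻¹ • v) : U) : V)) : TangentSpace 𝓘(ℝ,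 V) ((extChartAt 𝓘(ℝ, V) u₀).symm (‖v‖⁻¹ • v)))) : U) : V)) →
      ContDiffOn ℝ ∞ Cf {v : V | 1 - ε < ‖v‖ ∧ ‖v‖ < 1 + ε} ∧
      (∀ u : V, ‖u‖ = 1 → Cf u = u) ∧
      (∀ u : V, ‖u‖ = 1 → fderiv ℝ Cf u u =
        (Real.sqrt (GU u ((GU u).inverse (innerSL ℝ u)) ((GU u).inverse (innerSL ℝ u))))⁻¹ •
          (GU u).inverse (innerSL ℝ u)) ∧
      (∀ v : V, 1 - ε < ‖v‖ → ‖v‖ < 1 + ε →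
        GU (Cf v) (fderiv ℝ Cf v v) (fderiv ℝ Cf v v) = ‖v‖ ^ 2 ∧
        ∀ β : V, ⟪v, β⟫ = 0 → GU (Cf v) (fderiv ℝ Cf v v) (fderiv ℝ Cf v β) = 0) := by
  haveI : Fact (finrank ℝ V = d + 1) := ⟨hdimE⟩
  haveI : CompleteSpace V := FiniteDimensional.complete ℝ V
  haveI : CovariantDerivative.ContMDiffCovariantDerivative gU.leviCivita ∞ :=
    contMDiffCovariantDerivative_leviCivita_infty gU le_rfl
  haveI : CovariantDerivative.ContMDiffCovariantDerivative gU.leviCivita 1 :=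
    ⟨gU.isLocallyContMDiff_leviCivita_holds 1 (by exact_mod_cast le_top) univ isOpen_univ⟩
  /- ── the hypersurface data ── -/
  set ι : V → U := fun v ↦ (extChartAt 𝓘(ℝ, V) u₀).symm (‖v‖⁻¹ • v) with hι
  set Nr : V → V := fun w ↦ (GU w).inverse (innerSL ℝ w) with hNr
  set νf : V → V := fun w ↦ (Real.sqrt (GU w (Nr w) (Nr w)))⁻¹ • Nr w with hνf
  set ν : Π v : V, TangentSpace 𝓘(ℝ, V) (ι v) := fun v ↦ (νf ((ι v : U) : V) : TangentSpace 𝓘(ℝ, V) (ι v))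
    with hν
  have hιv : ∀ v : V, v ≠ 0 → ((ι v : U) : V) = ‖v‖⁻¹ • v := fun v hv ↦
    coe_spherePresentation u₀ hSU hv
  have hιunit : ∀ u : V, ‖u‖ = 1 → ((ι u : U) : V) = u := fun u hu ↦ by
    have hu0 : u ≠ 0 := by intro h; rw [h, norm_zero] at hu; exact zero_ne_one hu
    rw [hιv u hu0, hu, inv_one, one_smul]
  have hs : ContMDiffOn 𝓘(ℝ, V) 𝓘(ℝ, V).tangent ∞
      (fun v ↦ (TotalSpace.mk' V (ι v) (ν v) : TangentBundle 𝓘(ℝ, V) U)) {v : V | v ≠ 0} :=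
    contMDiffOn_spherePresentation_normal gU GU hG hgU u₀ hSU
  have hhom : ∀ v : V, v ≠ 0 → ∀ t : ℝ, 0 < t →
      (TotalSpace.mk' V (ι (t • v)) (ν (t • v)) : TangentBundle 𝓘(ℝ, V) U) =
        TotalSpace.mk' V (ι v) (ν v) := fun v _ t ht ↦
    spherePresentation_normal_smul GU u₀ ht v
  have hunit : ∀ v : V, v ≠ 0 → gU.val (ι v) (ν v) (ν v) = 1 := by
    intro v hv
    have hp : ((ι v : U) : V) ≠ 0 := by
      rw [hιv v hv]; exact smul_ne_zero (inv_ne_zero (norm_ne_zero_iff.2 hv)) hv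
    exact val_sphereNormal_self gU GU hG hgU (ι v) hp
  have hperp : ∀ v : V, v ≠ 0 → ∀ z : V, gU.val (ι v) (mfderiv 𝓘(ℝ, V) 𝓘(ℝ, V) ι v z) (ν v) = 0 :=
    fun v hv z ↦ val_mfderiv_spherePresentation_normal gU GU hG u₀ hSU hv z
  have himm : ∀ v : V, v ≠ 0 → ∀ z : V, ⟪v, z⟫ = 0 → mfderiv 𝓘(ℝ, V) 𝓘(ℝ, V) ι v z = 0 → z = 0 :=
    fun v hv z hz h0 ↦ mfderiv_spherePresentation_eq_zero u₀ hSU hv hz h0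
  have hinj : ∀ v w : V, ‖v‖ = 1 → ‖w‖ = 1 → ι v = ι w → v = w :=
    fun v w hv hw h ↦ spherePresentation_injOn u₀ hSU hv hw h
  /- ── the collar of the cone map ── -/
  obtain ⟨ε₀, hε₀, hdom, -, -⟩ := exists_injOn_coneMap gU (ι := ι) (ν := ν) hs hhom hunit hperp
    himm hinj hdimE
  set ε : ℝ := min ε₀ (1 / 2) with hεdef
  have hε : 0 < ε := lt_min hε₀ (by norm_num)
  have hε1 : ε < 1 := (min_le_right _ _).trans_lt (by norm_num)
  have hεε₀ : ε ≤ ε₀ := min_le_left _ _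
  set A : Set V := {v : V | 1 - ε < ‖v‖ ∧ ‖v‖ < 1 + ε} with hA
  have hAo : IsOpen A :=
    (isOpen_lt continuous_const continuous_norm).inter (isOpen_lt continuous_norm continuous_const)
  have h0A : (0 : V) ∉ A := by
    intro h; have := h.1; rw [norm_zero] at this; linarith
  have hA0 : ∀ v ∈ A, v ≠ 0 := fun v hv h ↦ h0A (h ▸ hv)
  have hAI : ∀ v ∈ A, ‖v‖ - 1 ∈ Ioo (-ε₀) ε₀ := fun v hv ↦
    ⟨by linarith [hv.1], by linarith [hv.2]⟩
  have hdomA : ∀ v ∈ A, (‖v‖ - 1) ∈ maximalGeodesicDomain gU.leviCivita (ι v) (ν v) :=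
    fun v hv ↦ hdom v (hA0 v hv) _ (hAI v hv)
  have hdomεA : ∀ v ∈ A, ∀ t ∈ Ioo (-ε₀) ε₀, t ∈ maximalGeodesicDomain gU.leviCivita (ι v) (ν v) :=
    fun v hv t ht ↦ hdom v (hA0 v hv) t ht
  have hsA := hs.mono (fun v hv ↦ hA0 v hv)
  have hhomA : ∀ v ∈ A, ∀ t : ℝ, 0 < t →
      (TotalSpace.mk' V (ι (t • v)) (ν (t • v)) : TangentBundle 𝓘(ℝ, V) U) =
        TotalSpace.mk' V (ι v) (ν v) := fun v hv t ht ↦ hhom v (hA0 v hv) t ht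
  set CN : V → U := fun v ↦ expMap gU.leviCivita (ι v) ((‖v‖ - 1) • ν v) with hCN
  have hCNs : ContMDiffOn 𝓘(ℝ, V) 𝓘(ℝ, V) ∞ CN A := contMDiffOn_coneMap gU hAo h0A hsA hdomA
  refine ⟨ε, hε, hε1, ?_⟩
  intro Cf hCf
  have hCfeq : Cf = (fun z : U ↦ (z : V)) ∘ CN := funext fun v ↦ hCf v
  /- ── smoothness ── -/
  have hCfsm : ContMDiffOn 𝓘(ℝ, V) 𝓘(ℝ, V) ∞ Cf A := by
    rw [hCfeq]
    exact contMDiff_subtype_val.comp_contMDiffOn hCNs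
  have hCfs : ContDiffOn ℝ ∞ Cf A := contMDiffOn_iff_contDiffOn.1 hCfsm
  /- ── the derivative in coordinates ── -/
  have hfd : ∀ v ∈ A, ∀ z : V, fderiv ℝ Cf v z = (mfderiv 𝓘(ℝ, V) 𝓘(ℝ, V) CN v z : V) := by
    intro v hv z
    have hCNd : MDifferentiableAt 𝓘(ℝ, V) 𝓘(ℝ, V) CN v :=
      ((hCNs v hv).contMDiffAt (hAo.mem_nhds hv)).mdifferentiableAt (by simp)
    have hvald : MDifferentiableAt 𝓘(ℝ, V) 𝓘(ℝ, V) (fun z : U ↦ (z : V)) (CN v) :=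
      (contMDiff_subtype_val (n := ∞) (CN v)).mdifferentiableAt (by simp)
    rw [← mfderiv_eq_fderiv, hCfeq, mfderiv_comp v hvald hCNd]
    exact mfderiv_subtype_val_apply (CN v) (mfderiv 𝓘(ℝ, V) 𝓘(ℝ, V) CN v z)
  /- ── `Cf u = u` on the unit sphere ── -/
  have hCfid : ∀ u : V, ‖u‖ = 1 → Cf u = u := by
    intro u hu
    rw [hCf]
    show ((expMap gU.leviCivita (ι u) ((‖u‖ - 1) • ν u) : U) : V) = u
    have h0 : (‖u‖ - 1) • ν u = 0 := by rw [hu, sub_self, zero_smul]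
    have h : expMap gU.leviCivita (ι u) (0 : TangentSpace 𝓘(ℝ, V) (ι u)) = ι u :=
      expMap_zero (cov := gU.leviCivita) (ι u)
    rw [h0, h]
    exact hιunit u hu
  /- ── the radial derivative on the sphere ── -/
  have hCfder : ∀ u : V, ‖u‖ = 1 → fderiv ℝ Cf u u = νf u := by
    intro u hu
    have hu0 : u ≠ 0 := by intro h; rw [h, norm_zero] at hu; exact zero_ne_one hu
    have huA : u ∈ A := ⟨by rw [hu]; linarith, by rw [hu]; linarith⟩
    rw [hfd u huA u, mfderiv_coneMap_apply_self gU hAo h0A hsA hdomA hhomA huA, hu, one_smul,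
      sub_self]
    have h := velocity_expMap_smul_zero (cov := gU.leviCivita) (ι u) (ν u)
    rw [h]
    show νf ((ι u : U) : V) = νf u
    rw [hιunit u hu]
  refine ⟨hCfs, hCfid, hCfder, ?_⟩
  /- ── the Gauss identities ── -/
  intro v hv1 hv2
  have hv : v ∈ A := ⟨hv1, hv2⟩
  have hv0 : v ≠ 0 := hA0 v hv
  have hbase : Cf v = ((CN v : U) : V) := hCf v
  have hGpt : ∀ a b : V, GU (Cf v) a b = gU.val (CN v) a b := by
    intro a b
    rw [hbase]
    exact (DFunLike.congr_fun (DFunLike.congr_fun (hG (CN v)) a) b).symm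
  constructor
  · rw [hGpt, hfd v hv v]
    have h := val_mfderiv_coneMap_self_self gU hAo h0A hsA hdomA hhomA hv
    rw [hunit v hv0, mul_one] at h
    exact h
  · intro β hβ
    rw [hGpt, hfd v hv v, hfd v hv β]
    have hsph : ∀ w : V, ‖w‖ = ‖v‖ → w ∈ A := fun w hw ↦ by rw [hA, mem_setOf_eq, hw]; exact hv
    exact val_mfderiv_coneMap_self_of_inner_eq_zero gU hAo h0A hsA hε₀ hdomεA hhomA
      (fun w hw ↦ hunit w (hA0 w hw)) (fun w hw z ↦ hperp w (hA0 w hw) z) (hAI v hv) hsph hβ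

end Literature.Geometry.Riemannian

end
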